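/-
Copyright (c) 2026 the pub-hodgecm-mathlib formalisation cell (harness21).  Prover seat hodgecm-mathlib-K2Liu-p13 (g4), Track B «K2-LIT»,
#184♮ = hLiu418 = `stmt-HodgeConjecture-24832`; ROAD Φ (RULING «M-156n»), #41 TOP, (β) END-file brick (E9) of the census `CENSUS-Beta-EndFile.K2Liu-p13-g4.md`:
THE LOCAL SIEGEL INTERTWINING INTEGRAND OF A SMOOTH SIEGEL SECTION IS INTEGRABLE OVER `N_Δ(F_v)` ON `1 < re s` (`n = 2`, EVERY finite place) — the integrability half of
★ A7's GK-cocycle road (★ B7-M2 `chain_integrability_of_forall_eq` ∕ ★ B7-M2s `chain_integrability_of_pair` + ★ B4d-3 `integral_frameConj_weylSiegel_eq_iterated_of_chain`),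
EXPORTED BY NAME (it was only used inside ★ `normalisedRegularity_of_forall_eq_allS0` ∕ `_of_pair_allS0`), then moved to ★ (E3)'s currency by ★ (E10c).
THEOREMS ONLY (no `def`, no `instance`, no named-fact hypothesis, no `sorry`).
-/
import Summits.HodgeConjecture.HodgeConjecture.Theorems.K2LiuA7NormalisedRegularityCMAllS0       -- ★ the A7 chain (B7-M2, B7-M2s, B4d-3, frames, coordinates, ★ B8-CM `exists_adaptedFrame`)
import Summits.HodgeConjecture.HodgeConjecture.Theorems.K2LiuUnipDeltaLocIntegralTransport     -- ★ (E10c) p862437 `integrable_weylDelta_mul_unipDeltaLoc_of_forall_haar`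
import Literature.NumberTheory.Automorphic.AdelicSecondCountable                              -- ★ `secondCountableTopology_adicCompletion`
import HarnessLib

/-!
# Crux `HLiu418`, ROAD Φ, organ Φ8 (row G6), brick (E9): LOCAL SIEGEL SECTIONS HAVE INTEGRABLE INTERTWINING INTEGRANDS ON `1 < re s` (`n = 2`)

Cell `hodgecm-mathlib`, crux item hLiu418 = `stmt-HodgeConjecture-24832` (helper lane, count-neutral).  WHY ((β) census v2 §1 (6a)): the Fubini step ★ p862082
`integral_eq_sum_of_pureTensor` of the END file needs, at each bad place `v ∈ T`, the INTEGRABILITY of `y ↦ G_s((w_Δ)_v · y · κ_v)` over `N_Δ(L⁺_v)` for the local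
factors `G_s ∈ I_v(s, χ_v)` of (E6′); ★ A7 proved it on the way to `M_v(s) G_s = aNorm·Fn` but never exported it.
* §1 (generic doubled datum of rank `2`, a frame `(D, Dinv, Q)` as in ★ B7): **`integrable_frameConj_weylSiegel_mul_of_forall_eq`** (one place of `E` above `v`) and
  **`integrable_frameConj_weylSiegel_mul_of_pair`** (two places) — `u ↦ f(φ(w_Δ^J)·u·h)` is `νN`-integrable for every smooth Siegel section `f ∈ I_v(s,χ_v)`, `χ_v` unitary,
  `1 < re s`, every `h`, every Haar `νN` (the setup of ★ `normalisedRegularity_of_forall_eq_allS0` ∕ `_of_pair_allS0` verbatim: coordinates ★ `exists_homeomorph_coordTwo`,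
  Haar relation ★ `exists_measure_eq_smul_map`, the majorant chain, ★ B4d-3 `.1`); **`integrable_weylDelta_mul`** — the `w_Δ`-form at EVERY place (★ B7-R `placesOver_cases'`,
  `w_Δ = m₀·φ(w_Δ^J)` ★ `weylDelta_eq_mul_frameConj_weylSiegel` with `m₀ ∈ P_Δ` ★ `isSiegelDelta_weylDelta_mul_frameConj_weylSiegel`: a constant multiple).
* §2 (the CM datum `(L⁺, L, c, δ_L; gramR, hermD)`, `n = 2`, frame by ★ B8-CM `exists_adaptedFrame`): **`integrable_weylDelta_mul_cm`** (★ D10 currency, every Haar `νN` on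
  `unipDeltaLocal`) and **`integrable_weylDelta_mul_unipDeltaLoc_cm`** — ★ (E3)'s currency: `Integrable (y ↦ G((evalPlace v (finPart w_Δ)) * ↑y * h)) ν` for every Haar `ν` on
  `unipDeltaLoc v` (★ (E10c) `integrable_weylDelta_mul_unipDeltaLoc_of_forall_haar`).
Sources: [Casselman1980, §3 Thm. 3.1]; [KudlaSweet1997, §1]; [HarrisKudlaSweet1996, §1 (1.12), §6 (6.14)]; [Tate1950, §2.4]; [GelbartRogawski1991, §3.1 Prop. 3.1.1].
HONEST LABEL.  Helper lemmas, count-neutral; `HC_CM` is proved only modulo the 7 printed citations (2 remaining named inputs: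
hLiu418 = `stmt-HodgeConjecture-24832`, h413 = `stmt-HodgeConjecture-24833`) until rung 0 closes.
-/

set_option autoImplicit false
set_option linter.dupNamespace false -- the mandated namespace repeats `HodgeConjecture.HodgeConjecture`

noncomputable section

open scoped Classical NNReal ENNReal
open NumberField IsDedekindDomain Matrix MeasureTheory Topology
open Literature.NumberTheory.GaloisRepresentations.IsNonarchimedeanLocalField
open Literature.NumberTheory.Automorphic Literature.NumberTheory.Automorphic.UnitaryGroup
open Literature.NumberTheory.GelbartRogawski1991.AdaptedBlocks
open Literature.NumberTheory.GelbartRogawski1991.UnitaryDualPair.LocalSplitting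
open Literature.NumberTheory.GelbartRogawski1991
open Literature.NumberTheory.K2Lit.LocalSiegelDoubled
open Summit.HodgeConjecture.HodgeConjecture.Cruxes.HLiu418.K2LiuQRationalDefs
open Summit.HodgeConjecture.HodgeConjecture.Cruxes.HLiu418.K2LiuLocalLFactorDefs
open Summit.HodgeConjecture.HodgeConjecture.Cruxes.HLiu418.K2LiuLocalSiegelIwasawaFrame
open Summit.HodgeConjecture.HodgeConjecture.Cruxes.HLiu418.K2LiuLocalSiegelIwasawa
open Summit.HodgeConjecture.HodgeConjecture.Cruxes.HLiu418.K2LiuDoubledUTwoTwoBorelFrame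
open Summit.HodgeConjecture.HodgeConjecture.Cruxes.HLiu418.K2LiuDoubledUTwoTwoWeylCocycle
open Summit.HodgeConjecture.HodgeConjecture.Cruxes.HLiu418.K2LiuDoubledUTwoTwoLevi
open Summit.HodgeConjecture.HodgeConjecture.Cruxes.HLiu418.K2LiuDoubledUTwoTwoFrameTransport
open Summit.HodgeConjecture.HodgeConjecture.Cruxes.HLiu418.K2LiuDoubledUTwoTwoUnipotentHaar
open Summit.HodgeConjecture.HodgeConjecture.Cruxes.HLiu418.K2LiuDoubledUTwoTwoLeviTransport
open Summit.HodgeConjecture.HodgeConjecture.Cruxes.HLiu418.K2LiuUnipDeltaRankOneCoordinates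
open Summit.HodgeConjecture.HodgeConjecture.Cruxes.HLiu418.K2LiuSiegelCocycleLetters
open Summit.HodgeConjecture.HodgeConjecture.Cruxes.HLiu418.K2LiuSiegelCocycleStageLetters
open Summit.HodgeConjecture.HodgeConjecture.Cruxes.HLiu418.K2LiuSiegelCocycleStageShort
open Summit.HodgeConjecture.HodgeConjecture.Cruxes.HLiu418.K2LiuSiegelCocycleChainShort
open Summit.HodgeConjecture.HodgeConjecture.Cruxes.HLiu418.K2LiuSiegelCocycleChainLong
open Summit.HodgeConjecture.HodgeConjecture.Cruxes.HLiu418.K2LiuSiegelIntertwiningCocycle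
open Summit.HodgeConjecture.HodgeConjecture.Cruxes.HLiu418.K2LiuRankOneStage
open Summit.HodgeConjecture.HodgeConjecture.Cruxes.HLiu418.K2LiuFlatSiegelFamilies
open Summit.HodgeConjecture.HodgeConjecture.Cruxes.HLiu418.K2LiuLocalRingPlaceDecomposition
open Summit.HodgeConjecture.HodgeConjecture.Cruxes.HLiu418.K2LiuA7NormalisedRegularitySetup
open Summit.HodgeConjecture.HodgeConjecture.Cruxes.HLiu418.K2LiuA7NormalisedRegularityMajorant
open Summit.HodgeConjecture.HodgeConjecture.Cruxes.HLiu418.K2LiuA7NormalisedRegularityMajorantSplit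
open Summit.HodgeConjecture.HodgeConjecture.Cruxes.HLiu418.K2LiuA7NormalisedRegularityCM (exists_adaptedFrame)
open Summit.HodgeConjecture.HodgeConjecture.Cruxes.HLiu418.K2LiuUnipDeltaLocIntegralTransport (integrable_weylDelta_mul_unipDeltaLoc_of_forall_haar)
open Summit.HodgeConjecture.HodgeConjecture.Cruxes.HLiu418.K2LiuSiegelUnipotentLocalDefs (unipDeltaLoc)

namespace Summit.HodgeConjecture.HodgeConjecture.Cruxes.HLiu418.K2LiuLocalSiegelSectionIntegrable

/-! ## §1 Generic doubled datum of rank `2`, in a frame -/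

section Generic

variable (F : Type) [Field F] [NumberField F] (E : Type) [Field E] [NumberField E] [Algebra F E]
  [Algebra.IsQuadraticExtension F E] (c : E ≃ₐ[F] E)
  {δ : E} (hcδ : c δ = -δ) (hδ : δ ≠ 0) {d : F} (hd : δ * δ = algebraMap F E d) (v : HeightOneSpectrum (𝓞 F))
  {T₂ : Matrix (Fin 2) (Fin 2) F} (hT₂ : T₂.IsSymm) {J₂D : Matrix (Fin (2 + 2)) (Fin (2 + 2)) E} (hJ₂D : J₂D = (gramD F 2 T₂).map (algebraMap F E))
  (D Dinv : Matrix (Fin 2) (Fin 2) F) (hDD : D * Dinv = 1) (hDD' : Dinv * D = 1) (Q : GL (Fin (2 + 2)) F)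
  (hQm : (Q : Matrix (Fin (2 + 2)) (Fin (2 + 2)) F) = Matrix.reindex (e₂ 2) (e₂ 2) (Matrix.fromBlocks 1 D 1 (-D)))
  (hQ : (Q : Matrix (Fin (2 + 2)) (Fin (2 + 2)) F)ᵀ * gramD F 2 T₂ * (Q : Matrix (Fin (2 + 2)) (Fin (2 + 2)) F) = (StdForm.antidiagonal (2 + 2)).over F)
  [MeasurableSpace (unipDeltaLocal F E c v 2 (JD := J₂D))] [BorelSpace (unipDeltaLocal F E c v 2 (JD := J₂D))]
  (νN : Measure (unipDeltaLocal F E c v 2 (JD := J₂D))) [νN.IsHaarMeasure]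
  {χv : ∀ w : PlacesOver E v, (w.1.adicCompletion E)ˣ →* ℂˣ} (hχ : ∀ (w' : PlacesOver E v) (x : (w'.1.adicCompletion E)ˣ), ‖((χv w' x : ℂˣ) : ℂ)‖ = 1)
  {s : ℂ} (hs : 1 < s.re) {f : UnitaryGroup.localPi E c (2 + 2) J₂D v → ℂ} (hf : IsLocalSiegelSection F E c hcδ hδ hd v 2 hT₂ hJ₂D χv s f) (hsm : IsSmooth F E c v 2 f)

include hcδ hδ hd hT₂ hDD hDD' hQm hχ hs hf hsm in
/-- **INTEGRABILITY OF `u ↦ f(φ(w_Δ^J)·u·h)`, ONE PLACE OF `E` ABOVE `v`** (`f` a smooth Siegel section of `I_v(s,χ_v)`, `χ_v` unitary, `1 < re s`): the setup of ★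
`normalisedRegularity_of_forall_eq_allS0` (coordinates of `N_Δ(F_v)`, Haar relation, a level of `f`) and the majorant chain ★ B7-M2 fed to ★ B4d-3 (its `.1`).
[cite: KudlaSweet1997, §1] [cite: Casselman1980, §3 Thm. 3.1] [cite: Tate1950, §2.4] -/
theorem integrable_frameConj_weylSiegel_mul_of_forall_eq (w : PlacesOver E v) (hw : ∀ w' : PlacesOver E v, w' = w) (h : UnitaryGroup.localPi E c (2 + 2) J₂D v) :
    Integrable (fun u : unipDeltaLocal F E c v 2 (JD := J₂D) =>
      f (FrameTransport.frameConj F E c v (2 + 2) hJ₂D (antidiagonal_over_eq_map F E 2) Q hQ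
            (toLocalFour F E c v (weylSiegel (UnitaryGroup.LocalRing E v) (UnitaryGroup.conjLocal E c v))) * (u : UnitaryGroup.localPi E c (2 + 2) J₂D v) * h)) νN := by
  -- topology and measures on `F_v`, `E_w`, `E ⊗ F_v`
  haveI := secondCountableTopology_adicCompletion F v
  haveI : ∀ w' : PlacesOver E v, SecondCountableTopology (w'.1.adicCompletion E) := fun w' => secondCountableTopology_adicCompletion E w'.1
  borelize (v.adicCompletion F) (w.1.adicCompletion E) (UnitaryGroup.LocalRing E v)
  obtain ⟨μF, hμF⟩ : ∃ μ : Measure (v.adicCompletion F), μ.IsAddHaarMeasure := ⟨Measure.addHaar, inferInstance⟩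
  obtain ⟨μw, hμw⟩ : ∃ μ : Measure (w.1.adicCompletion E), μ.IsAddHaarMeasure := ⟨Measure.addHaar, inferInstance⟩
  obtain ⟨e₁, he₁, he₁add⟩ := exists_homeomorph_single_of_forall_eq F E v w hw
  haveI hμR : (Measure.map (⇑e₁) μw).IsAddHaarMeasure :=
    AddEquiv.isAddHaarMeasure_map μw ({ toFun := e₁, invFun := e₁.symm, left_inv := e₁.symm_apply_apply, right_inv := e₁.apply_symm_apply, map_add' := he₁add } :
      w.1.adicCompletion E ≃+ UnitaryGroup.LocalRing E v) e₁.continuous e₁.symm.continuous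
  -- the coordinates of `N_Δ(F_v)` and the Haar relation
  obtain ⟨e3, he3'⟩ := exists_homeomorph_coordTwo F E c hcδ hδ v hJ₂D D Dinv hDD hDD' Q hQm hQ
  have he3 := he3'.1
  obtain ⟨cN, -, hν⟩ := exists_measure_eq_smul_map F E c v e3 he3'.2 νN μF (Measure.map (⇑e₁) μw)
  -- a level of `f` and the letter `A`
  obtain ⟨K', hK'⟩ := hsm
  obtain ⟨A, hA⟩ := exists_partialWeylGL F E v w
  -- the majorant chain and ★ B4d-3
  have hch := chain_integrability_of_forall_eq F E c hcδ hδ hd v hT₂ hJ₂D D Dinv hDD Q hQm hQ μF e3 he3 hχ hs hf ⟨K', hK'⟩ K' hK' w hw μw e₁ he₁ A hA h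
  exact (integral_frameConj_weylSiegel_eq_iterated_of_chain F E c hcδ hδ v hJ₂D Q hQ e3 he3 νN μF (Measure.map (⇑e₁) μw) cN hν f h
    hch.1 hch.2.1 hch.2.2.1 hch.2.2.2).1

include hcδ hδ hd hT₂ hDD hDD' hQm hχ hs hf hsm in
/-- **INTEGRABILITY OF `u ↦ f(φ(w_Δ^J)·u·h)`, TWO PLACES OF `E` ABOVE `v`** (split place; the majorant chain ★ B7-M2s `chain_integrability_of_pair`).
[cite: KudlaSweet1997, §1] [cite: Casselman1980, §3 Thm. 3.1] [cite: Tate1950, §2.4] -/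
theorem integrable_frameConj_weylSiegel_mul_of_pair (w₁ w₂ : PlacesOver E v) (hne : w₁ ≠ w₂) (hw : ∀ w' : PlacesOver E v, w' = w₁ ∨ w' = w₂)
    (h : UnitaryGroup.localPi E c (2 + 2) J₂D v) :
    Integrable (fun u : unipDeltaLocal F E c v 2 (JD := J₂D) =>
      f (FrameTransport.frameConj F E c v (2 + 2) hJ₂D (antidiagonal_over_eq_map F E 2) Q hQ
            (toLocalFour F E c v (weylSiegel (UnitaryGroup.LocalRing E v) (UnitaryGroup.conjLocal E c v))) * (u : UnitaryGroup.localPi E c (2 + 2) J₂D v) * h)) νN := by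
  haveI := secondCountableTopology_adicCompletion F v
  haveI : ∀ w' : PlacesOver E v, SecondCountableTopology (w'.1.adicCompletion E) := fun w' => secondCountableTopology_adicCompletion E w'.1
  borelize (v.adicCompletion F) (w₁.1.adicCompletion E) (w₂.1.adicCompletion E) (UnitaryGroup.LocalRing E v)
  obtain ⟨μF, hμF⟩ : ∃ μ : Measure (v.adicCompletion F), μ.IsAddHaarMeasure := ⟨Measure.addHaar, inferInstance⟩
  obtain ⟨μ₁, hμ₁⟩ : ∃ μ : Measure (w₁.1.adicCompletion E), μ.IsAddHaarMeasure := ⟨Measure.addHaar, inferInstance⟩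
  obtain ⟨μ₂, hμ₂⟩ : ∃ μ : Measure (w₂.1.adicCompletion E), μ.IsAddHaarMeasure := ⟨Measure.addHaar, inferInstance⟩
  haveI hμ12 : (μ₁.prod μ₂).IsAddHaarMeasure := Measure.prod.instIsAddHaarMeasure μ₁ μ₂
  obtain ⟨e₂, he₂, he₂add⟩ := exists_homeomorph_single_add_single F E v w₁ w₂ hne hw
  haveI hμR : (Measure.map (⇑e₂) (μ₁.prod μ₂)).IsAddHaarMeasure :=
    AddEquiv.isAddHaarMeasure_map (μ₁.prod μ₂) ({ toFun := e₂, invFun := e₂.symm, left_inv := e₂.symm_apply_apply, right_inv := e₂.apply_symm_apply, map_add' := he₂add } :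
      (w₁.1.adicCompletion E × w₂.1.adicCompletion E) ≃+ UnitaryGroup.LocalRing E v) e₂.continuous e₂.symm.continuous
  obtain ⟨e3, he3'⟩ := exists_homeomorph_coordTwo F E c hcδ hδ v hJ₂D D Dinv hDD hDD' Q hQm hQ
  have he3 := he3'.1
  obtain ⟨cN, -, hν⟩ := exists_measure_eq_smul_map F E c v e3 he3'.2 νN μF (Measure.map (⇑e₂) (μ₁.prod μ₂))
  obtain ⟨K', hK'⟩ := hsm
  obtain ⟨A₁, hA₁⟩ := exists_partialWeylGL F E v w₁
  obtain ⟨A₂, hA₂⟩ := exists_partialWeylGL F E v w₂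
  have hch := chain_integrability_of_pair F E c hcδ hδ hd v hT₂ hJ₂D D Dinv hDD Q hQm hQ μF e3 he3 hχ hs hf ⟨K', hK'⟩ K' hK' w₁ w₂ hne hw μ₁ μ₂ e₂ he₂ A₁ hA₁ A₂ hA₂ h
  exact (integral_frameConj_weylSiegel_eq_iterated_of_chain F E c hcδ hδ v hJ₂D Q hQ e3 he3 νN μF (Measure.map (⇑e₂) (μ₁.prod μ₂)) cN hν f h
    hch.1 hch.2.1 hch.2.2.1 hch.2.2.2).1

include hcδ hδ hd hT₂ hDD hDD' hQm hQ hχ hs hf hsm in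
/-- **THE LOCAL SIEGEL INTERTWINING INTEGRAND IS INTEGRABLE** (generic doubled datum of rank `2` with a frame, EVERY finite place): for a smooth Siegel section
`f ∈ I_v(s, χ_v)`, `χ_v` unitary, `1 < re s`, every `h ∈ H_v` and every Haar `νN` on `N_Δ(F_v)`, `u ↦ f(w_Δ·u·h)` is `νN`-integrable (`w_Δ = m₀·φ(w_Δ^J)`, `m₀ ∈ P_Δ`:
a constant multiple of the framed integrand; ★ B7-R `placesOver_cases'`). [cite: Casselman1980, §3 Thm. 3.1] [cite: KudlaSweet1997, §1] [cite: HarrisKudlaSweet1996, §1 (1.12)] -/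
theorem integrable_weylDelta_mul (h : UnitaryGroup.localPi E c (2 + 2) J₂D v) :
    Integrable (fun u : unipDeltaLocal F E c v 2 (JD := J₂D) => f (weylDelta F E c v 2 hJ₂D * (u : UnitaryGroup.localPi E c (2 + 2) J₂D v) * h)) νN := by
  have hframe : Integrable (fun u : unipDeltaLocal F E c v 2 (JD := J₂D) =>
      f (FrameTransport.frameConj F E c v (2 + 2) hJ₂D (antidiagonal_over_eq_map F E 2) Q hQ
            (toLocalFour F E c v (weylSiegel (UnitaryGroup.LocalRing E v) (UnitaryGroup.conjLocal E c v))) * (u : UnitaryGroup.localPi E c (2 + 2) J₂D v) * h)) νN := by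
    rcases placesOver_cases' F E c v hcδ hδ with ⟨w, hw⟩ | ⟨w₁, w₂, hne, hw⟩
    · exact integrable_frameConj_weylSiegel_mul_of_forall_eq F E c hcδ hδ hd v hT₂ hJ₂D D Dinv hDD hDD' Q hQm hQ νN hχ hs hf hsm w hw h
    · exact integrable_frameConj_weylSiegel_mul_of_pair F E c hcδ hδ hd v hT₂ hJ₂D D Dinv hDD hDD' Q hQm hQ νN hχ hs hf hsm w₁ w₂ hne hw h
  refine (hframe.const_mul (localSiegelCharacter F E c v 2 χv s (weylDelta F E c v 2 hJ₂D (T₀ := T₂) *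
    FrameTransport.frameConj F E c v (2 + 2) hJ₂D (antidiagonal_over_eq_map F E 2) Q hQ (toLocalFour F E c v (weylSiegel (UnitaryGroup.LocalRing E v) (UnitaryGroup.conjLocal E c v)))))).congr
    (Filter.Eventually.of_forall fun u => ?_)
  show _ = f (weylDelta F E c v 2 hJ₂D * (u : UnitaryGroup.localPi E c (2 + 2) J₂D v) * h)
  conv_rhs => rw [weylDelta_eq_mul_frameConj_weylSiegel F E c v hJ₂D Q hQ]
  rw [mul_assoc, mul_assoc, hf _ (isSiegelDelta_weylDelta_mul_frameConj_weylSiegel F E c hcδ hδ hd v hT₂ hJ₂D D Dinv hDD Q hQm hQ), ← mul_assoc]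

end Generic

/-! ## §2 The CM datum `(L⁺, L, c, δ_L; T = gramR, J = hermD)`, `n = 2`: D10 currency and ★ (E3)'s currency -/

section CM

variable (L : Type) [Field L] [NumberField L] [IsCMField L] {N M : ℕ} (e : Fin N × Fin M ≃ Fin 2)
  (dV : Fin N → L) (hdV : ∀ i, IsCMField.complexConj L (dV i) = dV i) (hdV0 : ∀ i, dV i ≠ 0)
  (dW : Fin M → L) (hdW : ∀ i, IsCMField.complexConj L (dW i) = dW i) (hdW0 : ∀ i, dW i ≠ 0)
  (v : HeightOneSpectrum (𝓞 (GRConstruction.Fp L)))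

set_option maxHeartbeats 400000 in
include hdV0 hdW0 in
/-- **(E9) AT THE CM DATUM, ★ D10 CURRENCY**: for every finite place `v` of `L⁺`, every unitary `χ_v`, every smooth Siegel section `f ∈ I_v(s, χ_v)` with `1 < re s`, every `h`
and every Haar `νN` on `unipDeltaLocal`: `u ↦ f(w_Δ·u·h)` is `νN`-integrable (§1 with the frame of ★ B8-CM `exists_adaptedFrame`, ★ `gramR_isSymm`, ★ `isUnit_det_gramR₀`).
[cite: GelbartRogawski1991, §3.1 Prop. 3.1.1] [cite: Casselman1980, §3 Thm. 3.1] [cite: KudlaSweet1997, §1] -/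
theorem integrable_weylDelta_mul_cm
    [MeasurableSpace (unipDeltaLocal (GRConstruction.Fp L) L (IsCMField.complexConj L) v 2 (JD := GRConstruction.hermD L e dV hdV dW hdW))]
    [BorelSpace (unipDeltaLocal (GRConstruction.Fp L) L (IsCMField.complexConj L) v 2 (JD := GRConstruction.hermD L e dV hdV dW hdW))]
    (νN : Measure (unipDeltaLocal (GRConstruction.Fp L) L (IsCMField.complexConj L) v 2 (JD := GRConstruction.hermD L e dV hdV dW hdW))) [νN.IsHaarMeasure]
    {χv : ∀ w : PlacesOver L v, (w.1.adicCompletion L)ˣ →* ℂˣ} (hχ : ∀ (w' : PlacesOver L v) (x : (w'.1.adicCompletion L)ˣ), ‖((χv w' x : ℂˣ) : ℂ)‖ = 1)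
    {s : ℂ} (hs : 1 < s.re) {f : UnitaryGroup.localPi L (IsCMField.complexConj L) (2 + 2) (GRConstruction.hermD L e dV hdV dW hdW) v → ℂ}
    (hf : haveI : Algebra.IsQuadraticExtension (GRConstruction.Fp L) L := IsCMField.isQuadraticExtension L
      IsLocalSiegelSection (GRConstruction.Fp L) L (IsCMField.complexConj L) (UnitaryDualPair.complexConj_imagUnit L) (UnitaryDualPair.imagUnit_ne_zero L)
        (UnitaryDualPair.imagUnit_mul_self L) v 2 (GRConstruction.gramR_isSymm L e dV hdV dW hdW) (GRConstruction.hermD_eq_map_gramD L e dV hdV dW hdW) χv s f)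
    (hsm : IsSmooth (GRConstruction.Fp L) L (IsCMField.complexConj L) v 2 f) (h : UnitaryGroup.localPi L (IsCMField.complexConj L) (2 + 2) (GRConstruction.hermD L e dV hdV dW hdW) v) :
    Integrable (fun u : unipDeltaLocal (GRConstruction.Fp L) L (IsCMField.complexConj L) v 2 (JD := GRConstruction.hermD L e dV hdV dW hdW) =>
      f (weylDelta (GRConstruction.Fp L) L (IsCMField.complexConj L) v 2 (GRConstruction.hermD_eq_map_gramD L e dV hdV dW hdW) *
        (u : UnitaryGroup.localPi L (IsCMField.complexConj L) (2 + 2) (GRConstruction.hermD L e dV hdV dW hdW) v) * h)) νN := by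
  haveI : Algebra.IsQuadraticExtension (GRConstruction.Fp L) L := IsCMField.isQuadraticExtension L
  obtain ⟨D, Dinv, Q, hDD, hDD', hQm, hQ⟩ :=
    exists_adaptedFrame (GRConstruction.Fp L) 2 (GRConstruction.gramR_isSymm L e dV hdV dW hdW) (GRConstruction.isUnit_det_gramR₀ L e dV hdV hdV0 dW hdW hdW0)
  exact integrable_weylDelta_mul (GRConstruction.Fp L) L (IsCMField.complexConj L) (UnitaryDualPair.complexConj_imagUnit L) (UnitaryDualPair.imagUnit_ne_zero L)
    (UnitaryDualPair.imagUnit_mul_self L) v (GRConstruction.gramR_isSymm L e dV hdV dW hdW) (GRConstruction.hermD_eq_map_gramD L e dV hdV dW hdW)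
    D Dinv hDD hDD' Q hQm hQ νN hχ hs hf hsm h

include hdV0 hdW0 in
/-- **(E9) AT THE CM DATUM, ★ (E3)'s CURRENCY**: for every finite place `v` of `L⁺`, every unitary `χ_v`, every smooth Siegel section `G ∈ I_v(s, χ_v)` with `1 < re s`, every
`h ∈ H(L⁺_v)` and every Haar measure `ν` on the global-comap `unipDeltaLoc v`:  `y ↦ G((evalPlace v (finPart w_Δ)) · ↑y · h)` is `ν`-integrable — the letter `hG` of
★ p862082 `integral_eq_sum_of_pureTensor` at a bad place (★ (E10c) transport of `integrable_weylDelta_mul_cm`). [cite: Casselman1980, §3 Thm. 3.1] [cite: KudlaSweet1997, §1] [cite: Kudla1994, §3] -/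
theorem integrable_weylDelta_mul_unipDeltaLoc_cm
    [MeasurableSpace ↥(unipDeltaLoc L e dV hdV dW hdW v)] [BorelSpace ↥(unipDeltaLoc L e dV hdV dW hdW v)]
    (ν : Measure ↥(unipDeltaLoc L e dV hdV dW hdW v)) [ν.IsHaarMeasure]
    {χv : ∀ w : PlacesOver L v, (w.1.adicCompletion L)ˣ →* ℂˣ} (hχ : ∀ (w' : PlacesOver L v) (x : (w'.1.adicCompletion L)ˣ), ‖((χv w' x : ℂˣ) : ℂ)‖ = 1)
    {s : ℂ} (hs : 1 < s.re) {G : UnitaryGroup.localPi L (IsCMField.complexConj L) (2 + 2) (GRConstruction.hermD L e dV hdV dW hdW) v → ℂ}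
    (hG : haveI : Algebra.IsQuadraticExtension (GRConstruction.Fp L) L := IsCMField.isQuadraticExtension L
      IsLocalSiegelSection (GRConstruction.Fp L) L (IsCMField.complexConj L) (UnitaryDualPair.complexConj_imagUnit L) (UnitaryDualPair.imagUnit_ne_zero L)
        (UnitaryDualPair.imagUnit_mul_self L) v 2 (GRConstruction.gramR_isSymm L e dV hdV dW hdW) (GRConstruction.hermD_eq_map_gramD L e dV hdV dW hdW) χv s G)
    (hsm : IsSmooth (GRConstruction.Fp L) L (IsCMField.complexConj L) v 2 G) (h : UnitaryGroup.localPi L (IsCMField.complexConj L) (2 + 2) (GRConstruction.hermD L e dV hdV dW hdW) v) :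
    Integrable (fun y : ↥(unipDeltaLoc L e dV hdV dW hdW v) =>
      G (UnitaryGroup.evalPlace (GRConstruction.Fp L) L (IsCMField.complexConj L) (2 + 2) (GRConstruction.hermD L e dV hdV dW hdW) v
            (UnitaryGroup.finPart (GRConstruction.Fp L) L (IsCMField.complexConj L) (2 + 2) (GRConstruction.hermD L e dV hdV dW hdW) (Literature.NumberTheory.K2Lit.SiegelDoubled.weylDelta L e dV hdV dW hdW)) *
          (y : UnitaryGroup.localPi L (IsCMField.complexConj L) (2 + 2) (GRConstruction.hermD L e dV hdV dW hdW) v) * h)) ν :=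
  integrable_weylDelta_mul_unipDeltaLoc_of_forall_haar L e dV hdV dW hdW v ν G h fun νN => integrable_weylDelta_mul_cm L e dV hdV hdV0 dW hdW hdW0 v νN hχ hs hG hsm h

end CM

end Summit.HodgeConjecture.HodgeConjecture.Cruxes.HLiu418.K2LiuLocalSiegelSectionIntegrable

end
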